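import Summits.ValiantsHypothesis.ValiantsHypothesis.Theorems.KPlusLogSqLawTropicalBMarkedEdgeCoreSix
import Summits.ValiantsHypothesis.ValiantsHypothesis.Theorems.KPlusLogSqLawTropicalBMarkedEdgeFourBitDominant

/-!
# Route «KPlusLogSqLaw», crux `TropicalB` (stmt-ValiantsHypothesis-19771) — MARKED-EDGE sector:
# the nested-triangle core on SIX nodes in the tree's currency (`IsDominant` / `termSign` / `tropWeight`)

HONEST FRAMING.  Helper file (cell `pub-symmetroid`, seat val-sym-trop-p4 (g17), 2026-08-28; `--supports stmt-ValiantsHypothesis-19771 --as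
helper`).  Reading of the kernel theorem `CoreSix.nestedTriangle_not_realisable_six` (p664896; abstract covers on `Fin 6`) for DOMINANCE
DESIGNS of the cell, through g16's bridge `FourBit.isMax_of_isDominant` (…MarkedEdgeFourBitDominant): in the lineage's MARKED-EDGE SECTOR with
FIVE marked bits on SIX nodes — format `(6, 6)`, exponents `d = (0, 1, 2, 4, 8, 16)`, class `l + 1` only on the diagonal cell `(l, l)` for
`l < 5` (marked loops of slopes `1, 2, 4, 8, 16`), class `0` only on every other cell, ANY support and valuations — there are no four terms,
dominant at four integer slopes, whose sets of used marked loops are `{1,2}`, `{1,3}`, `{2,3}`, `{0,4}` (slopes 6, 10, 12, 17): the located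
NESTED-TRIANGLE CORE of trop-p5 g18 / this seat (memo LAYER2-CORE-g17.md) is not realisable on six nodes.  Scope: six nodes only (m = 7, 8 are
located-exact, larger m open).  Nothing here concerns general designs, `TropicalB` in its window, `WeakLifting`, the doors, `MatrixDescartes`
(stmt-ValiantsHypothesis-18050) or VP ≠ VNP.
-/

set_option linter.dupNamespace false
set_option autoImplicit false

namespace Summit.ValiantsHypothesis.ValiantsHypothesis.Theorems.KPlusLogSqLaw
namespace MarkedEdge
namespace CoreSix

open Finset
open Summit.ValiantsHypothesis.ValiantsHypothesis.Theorems.MatrixDescartes.Negative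

/-- **THE NESTED-TRIANGLE CORE IS NOT REALISABLE ON SIX NODES (marked-edge sector, tree currency).**  Format `(6, 6)`, exponents
`d = (0, 1, 2, 4, 8, 16)`; a present class on cell `(i, j)` is class `i + 1` if `i = j < 5` (the five MARKED LOOPS) and class `0` otherwise;
ANY support, ANY valuations.  There are no four terms, dominant at four integer slopes, whose sets of used marked loops are `{1,2}`, `{1,3}`,
`{2,3}`, `{0,4}`. [this seat's theorem; `CoreSix.nestedTriangle_not_realisable_six` read through `FourBit.isMax_of_isDominant`] -/
theorem markedEdge_nestedTriangle_six (d : Fin 6 → ℕ)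
    (hd : ∀ l : Fin 6, d l = if (l : ℕ) = 0 then 0 else 2 ^ ((l : ℕ) - 1)) (v ε : Fin 6 → Fin 6 → Fin 6 → ℤ)
    (hsec : ∀ (i j : Fin 6) (l : Fin 6), ε i j l ≠ 0 → (l : ℕ) = if i = j ∧ (i : ℕ) < 5 then (i : ℕ) + 1 else 0) :
    ¬ ∃ (θ : Fin 4 → ℤ) (p : Fin 4 → Equiv.Perm (Fin 6) × (Fin 6 → Fin 6)),
      (∀ k, IsDominant d v ε (θ k) (p k)) ∧
      ∀ n : Fin 6, (n : ℕ) < 5 →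
        ((p 0).1 n = n ↔ ((n : ℕ) = 1 ∨ (n : ℕ) = 2)) ∧ ((p 1).1 n = n ↔ ((n : ℕ) = 1 ∨ (n : ℕ) = 3)) ∧
        ((p 2).1 n = n ↔ ((n : ℕ) = 2 ∨ (n : ℕ) = 3)) ∧ ((p 3).1 n = n ↔ ((n : ℕ) = 0 ∨ (n : ℕ) = 4)) := by
  rintro ⟨θ, p, hdom, hpat⟩
  -- the class of a cell
  let cl : Fin 6 → Fin 6 → Fin 6 := fun i j => if h : i = j ∧ (i : ℕ) < 5 then ⟨(i : ℕ) + 1, by omega⟩ else 0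
  have hclval : ∀ i j : Fin 6, ((cl i j : Fin 6) : ℕ) = if i = j ∧ (i : ℕ) < 5 then (i : ℕ) + 1 else 0 := by
    intro i j
    by_cases h : i = j ∧ (i : ℕ) < 5
    · simp only [cl, dif_pos h, if_pos h]
    · simp only [cl, dif_neg h, if_neg h, Fin.val_zero]
  have hstatic : ∀ i j l, ε i j l ≠ 0 → l = cl i j := fun i j l h => Fin.ext (by rw [hsec i j l h, hclval])
  have hoffd : ∀ i j : Fin 6, i ≠ j → ε i j (cl i j) ≠ 0 → d (cl i j) = 0 := by
    intro i j hij _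
    have : cl i j = 0 := dif_neg (show ¬ (i = j ∧ (i : ℕ) < 5) from fun h => hij h.1)
    rw [this, hd]; rfl
  -- the abstract slope function of the bridge is the marked-edge slope function of `Fin 6`
  have hg : ∀ i j : Fin 6, (fun i j : Fin 6 => if j = i then (d (cl i i) : ℤ) else 0) i j
      = if i = j ∧ (i : ℕ) < 5 then (2 : ℤ) ^ (i : ℕ) else 0 := by
    intro i j
    show (if j = i then (d (cl i i) : ℤ) else 0) = _
    by_cases hij : i = j
    · subst hij
      rw [if_pos rfl]
      by_cases hi : (i : ℕ) < 5
      · have hc : cl i i = ⟨(i : ℕ) + 1, by omega⟩ := by simp only [cl, dif_pos (And.intro rfl hi)]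
        rw [if_pos (And.intro rfl hi), hc, hd]
        simp
      · have hc : cl i i = 0 := dif_neg (fun h => hi h.2)
        rw [if_neg (fun h => hi h.2), hc, hd]
        simp
    · rw [if_neg (Ne.symm hij), if_neg (fun h => hij h.1)]
  -- the marked nodes and the patterns
  let n₀ : Fin 6 := 0
  let n₁ : Fin 6 := 1
  let n₂ : Fin 6 := 2
  let n₃ : Fin 6 := 3
  let n₄ : Fin 6 := 4
  obtain ⟨b0, c0, e0, z0⟩ := hpat n₀ (by decide)
  obtain ⟨b1, c1, e1, z1⟩ := hpat n₁ (by decide)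
  obtain ⟨b2, c2, e2, z2⟩ := hpat n₂ (by decide)
  obtain ⟨b3, c3, e3, z3⟩ := hpat n₃ (by decide)
  obtain ⟨b4, c4, e4, z4⟩ := hpat n₄ (by decide)
  simp only [n₀, n₁, n₂, n₃, n₄] at b0 c0 e0 z0 b1 c1 e1 z1 b2 c2 e2 z2 b3 c3 e3 z3 b4 c4 e4 z4
  norm_num at b0 c0 e0 z0 b1 c1 e1 z1 b2 c2 e2 z2 b3 c3 e3 z3 b4 c4 e4 z4
  exact nestedTriangle_not_realisable_six (fun i j => ε j i (cl j i) ≠ 0) (fun i j => -v j i (cl j i))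
    (fun i j => if j = i then (d (cl i i) : ℤ) else 0) hg
    (FourBit.isMax_of_isDominant d v ε cl hstatic hoffd (hdom 0)) (FourBit.isMax_of_isDominant d v ε cl hstatic hoffd (hdom 1))
    (FourBit.isMax_of_isDominant d v ε cl hstatic hoffd (hdom 2)) (FourBit.isMax_of_isDominant d v ε cl hstatic hoffd (hdom 3))
    b1 b2 b0 b3 b4 c1 c3 c0 c2 c4 e2 e3 e0 e1 e4 z0 z4 z1 z2 z3

end CoreSix
end MarkedEdge
end Summit.ValiantsHypothesis.ValiantsHypothesis.Theorems.KPlusLogSqLaw
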